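import Summits.QuantumFields.YangMills.Theorems.BalabanUVNodesN11TStepOldBranchInnerChart
import Summits.QuantumFields.YangMills.Theorems.BalabanUVNodesN11TStepOldBranchInnerSumOfProvisos

/-!
# DAG node N11 — THE (O3′) DISJUNCTION WITH THE INSIDE STEP READ THROUGH ANY FIBRE-CHART SOCKET, WITHOUT ITS BOOKKEEPING ROWS: dag-n11-d's E §4
# (`…TStepOldBranchInnerChart`) `_of_laws` in the generic letters and `_of_provisos` in the Stage-13 letters — socket-GENERIC (dag-n11-w6's private coordinates, dag-n08-w2's
# kernel-level ∕ central-window charts, or any other socket of p610288's shape)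

HEADER — WORK-UNIT METADATA.  Cell `pub-ymgap`, YM-PLAN Track A (HUMAN RULING D-0062 ∕ D-0149), width seat `pub-ymgap-dag-n11-w2` (g4; WIDTH SEAT 2∕4 on N11 [B14]),
route `BalabanUVNodes`; this seat's jail key is K1⁷ `stmt-QuantumFields-20542` (`--kind proof --supports 20542 --as helper`, count-neutral); the K1 face of record since
KEY MAP v2 is K1⁹ `StabilityBRunRowsAtRecordR13SepCoPHV` = stmt-QuantumFields-27364 (MIS-KEY ∕ VALID rule R463 (4)(a): lineage BY NAME).  [I] = [Balaban1987RG1], [III] =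
[Balaban1988Convergent].  Over dag-n11-d g15's p628550 `…TStepOldBranchInnerChart` (★ `innerReading_of_oldBranch_piece_of_innerChart`: `hin₀` for ONE old-branch piece from ANY socket
`(κ, Ψ, J, S; hΨ, hJ, hpush, hfib)` of the inside step; `measurable_oldBranch_piece_comp_glue`; ★★★★★★ `slotsTOfRecord_succ_ae_eq_TkOfRecord_succ_of_oldBranchInnerChart` — its
`hint` edition, whose proof pattern §1 follows), this seat's p630030 `…OldBranchInnerSumOfProvisos` (§1 `…_of_oldBranchInnerSum_of_laws`), p626903 (`hgm_at_record₁₃_of_rows`), p628852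
(`hG_at_record₁₃_of_provisos`), dag-n11-d's p625485 C3 §3, dag-n21-d's `zetaOfRecord_nonneg`, def-T's `wOfRecord_nonneg` ∕ `Provisos₁₃CoPH.tstep` ∕ `WtOfRecord₁₃H_laws` ∕
`sect2Operand_pos`, K0c's `localBgMeasurable`, dag-n11-e's `B14SeparationOfRecord`.  Bus: CLAIM-9 of g4.

WHY THIS FILE.  dag-n11-d's private-coordinate files F ∕ G ∕ I specialise E to ONE socket (dag-n11-w6's).  Other sockets of the same shape exist or are coming (dag-n08-w2's
kernel-level chart at the central window, p629182 ∕ `…TStepInCentralWindowChart`; print's background-field chart if it is ever typed).  THIS FILE keeps the socket GENERIC and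
removes the bookkeeping rows as in this seat's earlier files: §1 is E §4 with `hint` ↦ `hgm` + weight laws + nonnegative operand (generic letters); §2 is its Stage-13 reading with
`hint` GONE, `hG₀` ∕ `hG` ∕ `hZ` ∕ `hw0` ∕ `hwm` ∕ `hχm` ∕ `hζm` ∕ `hwWm` DISCHARGED from `θ.Provisos₁₃CoPH`, `hgm` from the residual ∕ operand rows.  What a supplier using ANY socket
then owes for (O3′): the socket data + the support clause `hwS` + THE integral identity `hinner₀` on that chart (+ four residual rows and two operand rows, themselves named
currencies — `ResidualRowsAt`, `TermRowsAt` — and gone at `rePinH θ` ∕ read from term rows by this seat's other files).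

WHAT THIS FILE PROVES (0 `sorry`, 0 `def`, standard axioms).
§1 ★★★★★★ `slotsTOfRecord_succ_ae_eq_TkOfRecord_succ_of_oldBranchInnerChart_of_laws` (generic letters and socket: E §4 with `hint` ↦ `hgm` + `hW` + `hΦ0`).
§2 ★★★★★★★ `slotsTOfRecord₁₃H_succ_O3_of_hasSect2FormAtZS_of_innerChart_of_provisos` (Stage 13, generic socket: the (O3′) DISJUNCTION of `PresentChildObligations` for ANY `(t′, E′)`
from `θ.Provisos₁₃CoPH`, `hform`, the rows `hζ0m`∕`hqm`∕`hΦ₀m` and `hζm`∕`hqm'`∕`hΦm`, a socket `(κ, Ψ, J, S; hΨ, hJ, hpush, hfib)`, `hwS`, and `hinner₀` on the chart).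

HONEST FRAMING.  Helper lane, count-neutral; E §4's proof pattern over this seat's `_of_laws` old-branch theorem, and ONE Stage-13 composition, BY NAME; socket data, `hwS`, rows, the
level-`k` form and the integral identity DISPLAYED; NO chart of Bałaban's asserted; NO Jacobian evaluated; NO Gaussian integration; nothing of [I] §2 ∕ [III] §3 ∕ Thm 2 asserted;
(B4) ∕ (S-α) ∕ (O3′) NOT closed; N11 NOT discharged; K1⁹ NOT closed, no registered stub touched; counts unmoved (typed 28∕28 · discharged 5∕27 · A 5∕28).  One finite `𝕋⁴_{L^K}`
programme at fixed `ε = L^{−K}`; R4 closes only the conditional finite-𝕋⁴ rung `BalabanLadder.UV` — NOT ℝ⁴, NOT OS, NOT a mass gap, NOT Clay.  No `sorry`, `axiom`, `def`, `instance`,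
`notation`.  Sources (SHAPE ∕ bookkeeping only): [I] (0.4) p.253, §2 p.267; [III] Thm 1 p.262, Thm 2 p.263, §3 p.279, (2.18) p.257, (2.20)–(2.21) p.258, (3.1) p.264, (3.2)–(3.9)
pp.265–266, (3.16) p.268, (3.24)–(3.25) p.270; [Balaban1989LargeFieldI] (0.2)–(0.3) p.176.
-/

noncomputable section

open MeasureTheory ProbabilityTheory
open scoped ENNReal NNReal BigOperators Matrix.Norms.L2Operator

namespace Summit.QuantumFields.YangMills.Theorems.BalabanUVNodesN11TStepOldBranchInnerChartOfProvisos

open Literature.MathematicalPhysics.QuantumFieldTheory.Balaban1983to89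
open Literature.MathematicalPhysics.QuantumFieldTheory.Balaban1983to89.T4AveragingDisintegration
open BalabanUVNodesN11TStepOldBranchInnerChart (innerReading_of_oldBranch_piece_of_innerChart measurable_oldBranch_piece_comp_glue)
open BalabanUVNodesN11TStepOldBranchInnerSumOfProvisos (slotsTOfRecord_succ_ae_eq_TkOfRecord_succ_of_oldBranchInnerSum_of_laws)
open BalabanUVNodesN11TStepBranchSumAtRecord13OfLaws (hgm_at_record₁₃_of_rows)
open BalabanUVNodesN11TStepGraphIntegrableOfProvisos (hG_at_record₁₃_of_provisos)
open BalabanUVNodesN11TStepOldBranchGraphIntegrable (integrable_oldBranch_pieces₁₃H_of_integrable_graph)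
open BalabanUVNodesN11TkOpMeasurable (measurable_tkWeightsOfRecordP_ζ measurable_tkWeightsOfRecordP_w)
open N21StepWeightsPositivity (zetaOfRecord_nonneg)
open Literature.MathematicalPhysics.QuantumFieldTheory.Balaban1983to89.B14SeparationOfRecord (slotsTOfRecord_succ_eq_zero_of_init_eq_zero)
open Node00 hiding SU
open Node00.Tk T4Continuum B14.Eq218Concrete
open B10Eq42TorusConstraint (bondsIn)

variable {F : T4Family} {N : ℕ} [NeZero N]

/-! ## §1  Generic letters, generic socket: E §4 `_of_laws` -/

section Generic

variable {V : Type} [NormedAddCommGroup V] [InnerProductSpace ℝ V] [FiniteDimensional ℝ V] [MeasurableSpace V] [BorelSpace V]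

/-- ★★★★★★ **(O3′) ON THE NOSE FROM THE OLD-BRANCH DATA, INNER READINGS FROM ANY FIBRE-CHART SOCKET, `_of_laws`**: dag-n11-d's
`…TStepOldBranchInnerChart.slotsTOfRecord_succ_ae_eq_TkOfRecord_succ_of_oldBranchInnerChart` (p628550 §4) with p619836's conditional-integrability row `hint` REPLACED by joint
measurability `hgm` of the explicit NEW inside integrands, the NEW weights' laws `hW : W.Laws` and a NONNEGATIVE new operand `hΦ0`.  Everything else VERBATIM and DISPLAYED: (form),
(hG₀), the socket `(κ, Ψ, J, S; hΨ, hJ, hpush, hfib)`, (hwS), the measurability of `w`'s graph section ∕ `χ_k` ∕ `W₀.ζ` ∕ `W₀.w` ∕ the old operand, and (hinner₀) THE PER-OLD-BRANCH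
CHARTED IDENTIFICATION ON THE CHART.  Proof: E §4's, over this seat's `…_of_oldBranchInnerSum_of_laws` (p630030 §1).
[cite: Balaban1987RG1, (0.4) p.253, §2 p.267; Balaban1988Convergent, (2.18) p.257, (2.20)–(2.21) p.258, (3.1) p.264, (3.24)–(3.25) p.270, §3 p.279] -/
theorem slotsTOfRecord_succ_ae_eq_TkOfRecord_succ_of_oldBranchInnerChart_of_laws (ν : Stage7Numerics) (τ : TowerNumerics) (E : B12.RunParams → ℝ)
    (w : StepWeightsOfRecord F N ν τ.M) (ppSel : PpSelOfRecord F ν τ.M) (p : B12.RunParams) (g : ℕ → ℝ) {k : ℕ} (hkK : k < p.K)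
    {hdec : DecidableEq (PBond (F.P p.K) k)} {hdec' : DecidableEq (PBond (F.P p.K) (k + 1))} (hk : k + 1 ≤ (F.P p.K).m + (F.P p.K).K)
    (s' : SeqOfRecord F ν τ.M g p.K (k + 1)) (W₀ W : TkWeights F N V p.K)
    (Φ₀ Φ : SFluct (F.P p.K) V → B15DeterminingSets.MSField (F.P p.K) (SU N) → ℝ)
    (hform : ∀ᵐ U ∂fieldMeasure (F.P p.K) k (SU N), chiSeqOfRecord F N ν τ.M g p.K k s'.init U ≠ 0 →
      slotsOfRecord F N ν τ E w ppSel p g k s'.init U = TkOfRecord F N V ν τ.M g p.K W₀ k s'.init Φ₀ U)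
    (hG₀ : ∀ S₀ ∈ admSOfRecord F ν τ.M g p.K k s'.init, Integrable (fun U => w p g k s' U ((avOfRecord F N p.K k).avg U) *
        (chiSeqOfRecord F N ν τ.M g p.K k s'.init U *
          tkBranchOfRecord F N V ν τ.M g p.K W₀ s'.init S₀ k (fun ω => Φ₀ (S₀, fun j => (ω j).2) (fun j => (ω j).1)) (baseCfg k U)))
      (fieldMeasure (F.P p.K) k (SU N)))
    {X : Type*} [MeasurableSpace X] (κ : Kernel ((↥(Set.toFinite (bondsIn k (s'.Ω (k + 1))ᶜ)).toFinset → SU N) × ({c : PBond (F.P p.K) (k + 1) // c ∉ (Set.toFinite (bondsIn (k + 1) (s'.Ω (k + 1))ᶜ)).toFinset} → SU N)) X) [IsSFiniteKernel κ]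
    {Ψ : ((↥(Set.toFinite (bondsIn k (s'.Ω (k + 1))ᶜ)).toFinset → SU N) × ({c : PBond (F.P p.K) (k + 1) // c ∉ (Set.toFinite (bondsIn (k + 1) (s'.Ω (k + 1))ᶜ)).toFinset} → SU N)) × X → (↥(Set.toFinite (bondsIn k (s'.Ω (k + 1))ᶜ)).toFinset → SU N) × ({b : PBond (F.P p.K) k // b ∉ (Set.toFinite (bondsIn k (s'.Ω (k + 1))ᶜ)).toFinset} → SU N)} (hΨ : Measurable Ψ)
    {J : ((↥(Set.toFinite (bondsIn k (s'.Ω (k + 1))ᶜ)).toFinset → SU N) × ({c : PBond (F.P p.K) (k + 1) // c ∉ (Set.toFinite (bondsIn (k + 1) (s'.Ω (k + 1))ᶜ)).toFinset} → SU N)) × X → ℝ≥0} (hJ : Measurable J) {S : Set ((↥(Set.toFinite (bondsIn k (s'.Ω (k + 1))ᶜ)).toFinset → SU N) × ({b : PBond (F.P p.K) k // b ∉ (Set.toFinite (bondsIn k (s'.Ω (k + 1))ᶜ)).toFinset} → SU N))}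
    (hpush : ((((Measure.pi fun _ : ↥(Set.toFinite (bondsIn k (s'.Ω (k + 1))ᶜ)).toFinset => (HaarData.haar : Measure (SU N))).prod
          (Measure.pi fun _ : {c : PBond (F.P p.K) (k + 1) // c ∉ (Set.toFinite (bondsIn (k + 1) (s'.Ω (k + 1))ᶜ)).toFinset} =>
            (HaarData.haar : Measure (SU N)))) ⊗ₘ κ).withDensity (fun z => (J z : ℝ≥0∞))).map Ψ =
      (((Measure.pi fun _ : ↥(Set.toFinite (bondsIn k (s'.Ω (k + 1))ᶜ)).toFinset => (HaarData.haar : Measure (SU N))).prod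
          (Measure.pi fun _ : {b : PBond (F.P p.K) k // b ∉ (Set.toFinite (bondsIn k (s'.Ω (k + 1))ᶜ)).toFinset} => (HaarData.haar : Measure (SU N))))).restrict S)
    (hfib : ∀ᵐ z ∂((((Measure.pi fun _ : ↥(Set.toFinite (bondsIn k (s'.Ω (k + 1))ᶜ)).toFinset => (HaarData.haar : Measure (SU N))).prod
          (Measure.pi fun _ : {c : PBond (F.P p.K) (k + 1) // c ∉ (Set.toFinite (bondsIn (k + 1) (s'.Ω (k + 1))ᶜ)).toFinset} =>
            (HaarData.haar : Measure (SU N)))) ⊗ₘ κ).withDensity (fun z => (J z : ℝ≥0∞))),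
      (fun q => (q.1, fun c : {c : PBond (F.P p.K) (k + 1) // c ∉ (Set.toFinite (bondsIn (k + 1) (s'.Ω (k + 1))ᶜ)).toFinset} =>
          (avOfRecord F N p.K k).avg
            ((MeasurableEquiv.piEquivPiSubtypeProd (fun _ : PBond (F.P p.K) k => SU N)
              (· ∈ (Set.toFinite (bondsIn k (s'.Ω (k + 1))ᶜ)).toFinset)).symm q) c)) (Ψ z) = z.1)
    (hwS : ∀ q : (↥(Set.toFinite (bondsIn k (s'.Ω (k + 1))ᶜ)).toFinset → SU N) × ({b : PBond (F.P p.K) k // b ∉ (Set.toFinite (bondsIn k (s'.Ω (k + 1))ᶜ)).toFinset} → SU N), q ∉ S →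
      w p g k s' (⇑(MeasurableEquiv.piEquivPiSubtypeProd (fun _ : PBond (F.P p.K) k => SU N)
            (· ∈ (Set.toFinite (bondsIn k (s'.Ω (k + 1))ᶜ)).toFinset)).symm q) ((avOfRecord F N p.K k).avg (⇑(MeasurableEquiv.piEquivPiSubtypeProd (fun _ : PBond (F.P p.K) k => SU N)
            (· ∈ (Set.toFinite (bondsIn k (s'.Ω (k + 1))ᶜ)).toFinset)).symm q)) = 0)
    (hwm : Measurable fun U => w p g k s' U ((avOfRecord F N p.K k).avg U)) (hχm : Measurable (chiSeqOfRecord F N ν τ.M g p.K k s'.init))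
    (hζm : ∀ j Y, Measurable (W₀.ζ j Y)) (hwWm : ∀ j Λ' Y S, Measurable (W₀.w j Λ' Y S))
    (hΦ₀m : ∀ S₀ ∈ admSOfRecord F ν τ.M g p.K k s'.init,
      Measurable fun ω : MultiCfg (F.P p.K) (SU N) V => Φ₀ (S₀, fun j => (ω j).2) (fun j => (ω j).1))
    (hgm : ∀ S ∈ admSOfRecord F ν τ.M g p.K (k + 1) s', Measurable fun x :
        ((↥(Set.toFinite (bondsIn (k + 1) (s'.Ω (k + 1))ᶜ)).toFinset → SU N) ×
            ({c : PBond (F.P p.K) (k + 1) // c ∉ (Set.toFinite (bondsIn (k + 1) (s'.Ω (k + 1))ᶜ)).toFinset} → SU N)) ×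
          (↥(Set.toFinite (bondsIn k (s'.Ω (k + 1))ᶜ)).toFinset → SU N) =>
      zetaOp (genDataOfRecord F N V ν τ.M g p.K W s' S k).ζ
        (aOp k (genDataOfRecord F N V ν τ.M g p.K W s' S k).sA (genDataOfRecord F N V ν τ.M g p.K W s' S k).w
          (tkBranchOfRecord F N V ν τ.M g p.K W s' S k (fun ω => Φ (S, fun j => (ω j).2) (fun j => (ω j).1))))
        (Function.update (baseCfg (k + 1) ((MeasurableEquiv.piEquivPiSubtypeProd (fun _ : PBond (F.P p.K) (k + 1) => SU N)
                (· ∈ (Set.toFinite (bondsIn (k + 1) (s'.Ω (k + 1))ᶜ)).toFinset)).symm x.1)) k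
          (Function.updateFinset ((baseCfg (V := V) (k + 1) ((MeasurableEquiv.piEquivPiSubtypeProd (fun _ : PBond (F.P p.K) (k + 1) => SU N)
                (· ∈ (Set.toFinite (bondsIn (k + 1) (s'.Ω (k + 1))ᶜ)).toFinset)).symm x.1)) k).1 (Set.toFinite (bondsIn k (s'.Ω (k + 1))ᶜ)).toFinset x.2,
            ((baseCfg (V := V) (k + 1) ((MeasurableEquiv.piEquivPiSubtypeProd (fun _ : PBond (F.P p.K) (k + 1) => SU N)
                (· ∈ (Set.toFinite (bondsIn (k + 1) (s'.Ω (k + 1))ᶜ)).toFinset)).symm x.1)) k).2)))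
    (hW : W.Laws) (hΦ0 : ∀ S ∈ admSOfRecord F ν τ.M g p.K (k + 1) s', ∀ ω : MultiCfg (F.P p.K) (SU N) V, 0 ≤ Φ (S, fun j => (ω j).2) (fun j => (ω j).1))
    (hinner₀ : ∀ᵐ q ∂((Measure.pi fun _ : ↥(Set.toFinite (bondsIn (k + 1) (s'.Ω (k + 1))ᶜ)).toFinset => (HaarData.haar : Measure (SU N))).prod
          (Measure.pi fun _ : {c : PBond (F.P p.K) (k + 1) // c ∉ (Set.toFinite (bondsIn (k + 1) (s'.Ω (k + 1))ᶜ)).toFinset} =>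
            (HaarData.haar : Measure (SU N)))),
      ∀ S₀ ∈ admSOfRecord F ν τ.M g p.K k s'.init, ∀ y : ↥(Set.toFinite (bondsIn k (s'.Ω (k + 1))ᶜ)).toFinset → SU N,
        avgRestrOfRecord F N p.K k (Set.toFinite (bondsIn k (s'.Ω (k + 1))ᶜ)).toFinset (Set.toFinite (bondsIn (k + 1) (s'.Ω (k + 1))ᶜ)).toFinset y = q.1 →
        (∫ x, (J ((y, q.2), x) : ℝ) * ((fun U => w p g k s' U ((avOfRecord F N p.K k).avg U) *
        (chiSeqOfRecord F N ν τ.M g p.K k s'.init U *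
          tkBranchOfRecord F N V ν τ.M g p.K W₀ s'.init S₀ k (fun ω => Φ₀ (S₀, fun j => (ω j).2) (fun j => (ω j).1)) (baseCfg k U))) ∘
          ⇑(MeasurableEquiv.piEquivPiSubtypeProd (fun _ : PBond (F.P p.K) k => SU N)
            (· ∈ (Set.toFinite (bondsIn k (s'.Ω (k + 1))ᶜ)).toFinset)).symm) (Ψ ((y, q.2), x)) ∂(κ (y, q.2))) =
          ∑ Y ∈ (Set.toFinite {Y : Set (Site (F.P p.K) 0) | Y ∈ SClassOfRecord F ν g p.K (k + 1) ∧ Y ⊆ s'.Ω (k + 1) ∩ (s'.Λ (k + 1))ᶜ}).toFinset,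
            zetaOp (genDataOfRecord F N V ν τ.M g p.K W s' (Function.update S₀ (k + 1) Y) k).ζ
              (aOp k (genDataOfRecord F N V ν τ.M g p.K W s' (Function.update S₀ (k + 1) Y) k).sA
                (genDataOfRecord F N V ν τ.M g p.K W s' (Function.update S₀ (k + 1) Y) k).w
                (tkBranchOfRecord F N V ν τ.M g p.K W s'.init S₀ k
                  (fun ω => Φ (Function.update S₀ (k + 1) Y, fun j => (ω j).2) (fun j => (ω j).1))))
              (Function.update (baseCfg (k + 1) ((MeasurableEquiv.piEquivPiSubtypeProd (fun _ : PBond (F.P p.K) (k + 1) => SU N)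
                (· ∈ (Set.toFinite (bondsIn (k + 1) (s'.Ω (k + 1))ᶜ)).toFinset)).symm q)) k
              (Function.updateFinset ((baseCfg (V := V) (k + 1) ((MeasurableEquiv.piEquivPiSubtypeProd (fun _ : PBond (F.P p.K) (k + 1) => SU N)
                (· ∈ (Set.toFinite (bondsIn (k + 1) (s'.Ω (k + 1))ᶜ)).toFinset)).symm q)) k).1 (Set.toFinite (bondsIn k (s'.Ω (k + 1))ᶜ)).toFinset y,
                ((baseCfg (V := V) (k + 1) ((MeasurableEquiv.piEquivPiSubtypeProd (fun _ : PBond (F.P p.K) (k + 1) => SU N)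
                (· ∈ (Set.toFinite (bondsIn (k + 1) (s'.Ω (k + 1))ᶜ)).toFinset)).symm q)) k).2))) :
    slotsTOfRecord F N ν τ E w ppSel p g (k + 1) s' =ᵐ[fieldMeasure (F.P p.K) (k + 1) (SU N)] TkOfRecord F N V ν τ.M g p.K W (k + 1) s' Φ := by
  have hGm : ∀ S₀ ∈ admSOfRecord F ν τ.M g p.K k s'.init, Measurable ((fun U => w p g k s' U ((avOfRecord F N p.K k).avg U) *
        (chiSeqOfRecord F N ν τ.M g p.K k s'.init U *
          tkBranchOfRecord F N V ν τ.M g p.K W₀ s'.init S₀ k (fun ω => Φ₀ (S₀, fun j => (ω j).2) (fun j => (ω j).1)) (baseCfg k U))) ∘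
      ⇑(MeasurableEquiv.piEquivPiSubtypeProd (fun _ : PBond (F.P p.K) k => SU N)
            (· ∈ (Set.toFinite (bondsIn k (s'.Ω (k + 1))ᶜ)).toFinset)).symm) := fun S₀ h₀ =>
    measurable_oldBranch_piece_comp_glue ν τ w p g s' W₀ Φ₀ S₀ hwm hχm hζm hwWm (hΦ₀m S₀ h₀)
  refine slotsTOfRecord_succ_ae_eq_TkOfRecord_succ_of_oldBranchInnerSum_of_laws ν τ E w ppSel p g hkK (hdec := hdec) (hdec' := hdec') hk s' W₀ W Φ₀ Φ
    hform hG₀ (fun S₀ z => ∫ x, (J (z, x) : ℝ) * ((fun U => w p g k s' U ((avOfRecord F N p.K k).avg U) *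
        (chiSeqOfRecord F N ν τ.M g p.K k s'.init U *
          tkBranchOfRecord F N V ν τ.M g p.K W₀ s'.init S₀ k (fun ω => Φ₀ (S₀, fun j => (ω j).2) (fun j => (ω j).1)) (baseCfg k U))) ∘
          ⇑(MeasurableEquiv.piEquivPiSubtypeProd (fun _ : PBond (F.P p.K) k => SU N)
            (· ∈ (Set.toFinite (bondsIn k (s'.Ω (k + 1))ᶜ)).toFinset)).symm) (Ψ (z, x)) ∂(κ z)) (fun S₀ h₀ => ?_) (fun S₀ h₀ => ?_) hgm hW hΦ0 ?_
  · -- measurability of the chart's fibre integral of the piece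
    exact ((measurable_coe_nnreal_real.comp hJ).mul ((hGm S₀ h₀).comp hΨ)).stronglyMeasurable.integral_kernel_prod_right'.measurable
  · exact innerReading_of_oldBranch_piece_of_innerChart ν τ w p g hk s' W₀ Φ₀ S₀ κ hΨ hJ hpush hfib hwS (hGm S₀ h₀) (hG₀ S₀ h₀)
  · filter_upwards [hinner₀] with q hq S₀ h₀ y hy
    exact hq S₀ h₀ y hy

end Generic

/-! ## §2  Stage-13 letters, generic socket: the (O3′) DISJUNCTION `_of_provisos` -/

section Stage13

/-- ★★★★★★★ **THE (O3′) DISJUNCTION AT A v1.7 PARAMETER, INSIDE STEP READ THROUGH ANY FIBRE-CHART SOCKET, `_of_provisos`.**  At `θ : Stage13HParams F N` with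
`h : θ.Provisos₁₃CoPH F N`, run `p`, `k < K`, history `s′` of length `k+1`, a level-`k` witness family `(t, Ek)` with def-T's `HasSect2FormAtZS … law … t Ek` (ANY law package —
dag-n11-e's `ChainFormAt θ p σ k` is this) and ANY proposed `(t′, E′)`: given the measurability rows (residuals serving `init s′` and `s′`; old and new operand), a SOCKET
`(κ, Ψ, J, S; hΨ, hJ, hpush, hfib)` of the inside step in p610288's shape, the support clause `hwS` on the step weight's graph section, and THE PER-OLD-BRANCH INTEGRAL IDENTITY
`hinner₀` ON THAT CHART — the last conjunct of `…N11Sect3SupplyChainDefs.PresentChildObligations θ p k t tnew EkN s′` (at `t′ := graftAboveB k (t s′.init) (tnew s′)`, `E′ := EkN s′`)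
HOLDS.  Inside: `hG` (p628852 §2), `0 ≤ w` (`zetaOfRecord_nonneg` + `wOfRecord_nonneg`), `w`'s graph section measurable (`Provisos₁₃CoPH.tstep.measW` on the graph of `avOfRecord`), `χ_k`
measurable (`localBgMeasurable`), whence `hG₀` (dag-n11-d's C3 §3); the old weights' `ζ` ∕ `w` measurable (`measurable_tkWeightsOfRecordP_ζ ∕ _w`); `hgm` (p626903 §2); laws
(`WtOfRecord₁₃H_laws h.zhLaws`); positive operand (`sect2Operand_pos`); then §1; zero disjunct by `B14SeparationOfRecord`.
[cite: Balaban1988Convergent, Thm 1 p.262, Thm 2 p.263, §3 p.279, (3.24)–(3.25) p.270, (2.18) p.257, (2.20)–(2.21) p.258, (3.1) p.264, (3.2)–(3.9) pp.265–266; Balaban1987RG1, (0.4) p.253, §2 p.267] -/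
theorem slotsTOfRecord₁₃H_succ_O3_of_hasSect2FormAtZS_of_innerChart_of_provisos (θ : Stage13HParams F N) (h : θ.Provisos₁₃CoPH F N)
    (p : B12.RunParams) {k : ℕ} (hkK : k < p.K)
    {hdec : DecidableEq (PBond (F.P p.K) k)} {hdec' : DecidableEq (PBond (F.P p.K) (k + 1))} (hk : k + 1 ≤ (F.P p.K).m + (F.P p.K).K)
    (s' : SeqOfRecord F θ.ν θ.τ9.M (gOfRecord₁₃ F N θ.toStage13Params p) p.K (k + 1))
    {law : SeqOfRecord F θ.ν θ.τ9.M (gOfRecord₁₃ F N θ.toStage13Params p) p.K k → Sect2.TermValues (F.P p.K) (MatA N) (FluctV N) θ.τ9.M → Prop}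
    {t : SeqOfRecord F θ.ν θ.τ9.M (gOfRecord₁₃ F N θ.toStage13Params p) p.K k → Sect2.TermValues (F.P p.K) (MatA N) (FluctV N) θ.τ9.M}
    {Ek : SeqOfRecord F θ.ν θ.τ9.M (gOfRecord₁₃ F N θ.toStage13Params p) p.K k → ℝ}
    (hform : HasSect2FormAtZS F N (FluctV N) p.K (settingOfRecord₁₃ F N θ.toStage13Params p) k (θ.rzAt p) (WtOfRecord₁₃H F N θ p)
      (UbgOfRecord₁₃CoP F N θ.toStage13Params p k) law
      (slotsOfRecord F N θ.ν θ.τ9 (EOfRecord₁₃ F N θ.toStage13Params) (wOfRecord₉ F N θ.toStage9Params) θ.ppSel p (gOfRecord₁₃ F N θ.toStage13Params p) k) t Ek)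
    (t' : Sect2.TermValues (F.P p.K) (MatA N) (FluctV N) θ.τ9.M) (E' : ℝ)
    -- measurability of the residuals serving `init s′` and `s′` (dag-n11-e's `ResidualRowsAt` shapes), of the OLD and of the NEW operand
    (hζ0m : ∀ j Y, Measurable ((θ.zhAt p s'.init).ζ0 j Y)) (hqm : ∀ j Λ', Measurable ((θ.zhAt p s'.init).quad j Λ'))
    (hΦ₀m : ∀ S₀ ∈ admSOfRecord F θ.ν θ.τ9.M (gOfRecord₁₃ F N θ.toStage13Params p) p.K k s'.init,
      Measurable fun ω : MultiCfg (F.P p.K) (SU N) (FluctV N) =>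
        (sect2Operand F N (FluctV N) p.K (settingOfRecord₁₃ F N θ.toStage13Params p) (θ.rzAt p s'.init) s'.init (t s'.init) (Ek s'.init)
            (UbgOfRecord₁₃CoP F N θ.toStage13Params p k s'.init)) (S₀, fun j => (ω j).2) (fun j => (ω j).1))
    (hζm : ∀ j Y, Measurable ((θ.zhAt p s').ζ0 j Y)) (hqm' : ∀ j Λ', Measurable ((θ.zhAt p s').quad j Λ'))
    (hΦm : ∀ S ∈ admSOfRecord F θ.ν θ.τ9.M (gOfRecord₁₃ F N θ.toStage13Params p) p.K (k + 1) s',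
      Measurable fun ω : MultiCfg (F.P p.K) (SU N) (FluctV N) =>
        (sect2Operand F N (FluctV N) p.K (settingOfRecord₁₃ F N θ.toStage13Params p) (θ.rzAt p s') s' t' E'
            (UbgOfRecord₁₃CoP F N θ.toStage13Params p (k + 1) s')) (S, fun j => (ω j).2) (fun j => (ω j).1))
    -- A FIBRE-CHART SOCKET `(κ, Ψ, J, S)` OF THE INSIDE STEP (dag-n11-d's p610288 shape) + the support clause on the step weight's graph section
    {X : Type*} [MeasurableSpace X] (κ : Kernel ((↥(Set.toFinite (bondsIn k (s'.Ω (k + 1))ᶜ)).toFinset → SU N) × ({c : PBond (F.P p.K) (k + 1) // c ∉ (Set.toFinite (bondsIn (k + 1) (s'.Ω (k + 1))ᶜ)).toFinset} → SU N)) X) [IsSFiniteKernel κ]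
    {Ψ : ((↥(Set.toFinite (bondsIn k (s'.Ω (k + 1))ᶜ)).toFinset → SU N) × ({c : PBond (F.P p.K) (k + 1) // c ∉ (Set.toFinite (bondsIn (k + 1) (s'.Ω (k + 1))ᶜ)).toFinset} → SU N)) × X → (↥(Set.toFinite (bondsIn k (s'.Ω (k + 1))ᶜ)).toFinset → SU N) × ({b : PBond (F.P p.K) k // b ∉ (Set.toFinite (bondsIn k (s'.Ω (k + 1))ᶜ)).toFinset} → SU N)} (hΨ : Measurable Ψ)
    {J : ((↥(Set.toFinite (bondsIn k (s'.Ω (k + 1))ᶜ)).toFinset → SU N) × ({c : PBond (F.P p.K) (k + 1) // c ∉ (Set.toFinite (bondsIn (k + 1) (s'.Ω (k + 1))ᶜ)).toFinset} → SU N)) × X → ℝ≥0} (hJ : Measurable J) {S : Set ((↥(Set.toFinite (bondsIn k (s'.Ω (k + 1))ᶜ)).toFinset → SU N) × ({b : PBond (F.P p.K) k // b ∉ (Set.toFinite (bondsIn k (s'.Ω (k + 1))ᶜ)).toFinset} → SU N))}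
    (hpush : ((((Measure.pi fun _ : ↥(Set.toFinite (bondsIn k (s'.Ω (k + 1))ᶜ)).toFinset => (HaarData.haar : Measure (SU N))).prod
          (Measure.pi fun _ : {c : PBond (F.P p.K) (k + 1) // c ∉ (Set.toFinite (bondsIn (k + 1) (s'.Ω (k + 1))ᶜ)).toFinset} =>
            (HaarData.haar : Measure (SU N)))) ⊗ₘ κ).withDensity (fun z => (J z : ℝ≥0∞))).map Ψ =
      (((Measure.pi fun _ : ↥(Set.toFinite (bondsIn k (s'.Ω (k + 1))ᶜ)).toFinset => (HaarData.haar : Measure (SU N))).prod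
          (Measure.pi fun _ : {b : PBond (F.P p.K) k // b ∉ (Set.toFinite (bondsIn k (s'.Ω (k + 1))ᶜ)).toFinset} => (HaarData.haar : Measure (SU N))))).restrict S)
    (hfib : ∀ᵐ z ∂((((Measure.pi fun _ : ↥(Set.toFinite (bondsIn k (s'.Ω (k + 1))ᶜ)).toFinset => (HaarData.haar : Measure (SU N))).prod
          (Measure.pi fun _ : {c : PBond (F.P p.K) (k + 1) // c ∉ (Set.toFinite (bondsIn (k + 1) (s'.Ω (k + 1))ᶜ)).toFinset} =>
            (HaarData.haar : Measure (SU N)))) ⊗ₘ κ).withDensity (fun z => (J z : ℝ≥0∞))),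
      (fun q => (q.1, fun c : {c : PBond (F.P p.K) (k + 1) // c ∉ (Set.toFinite (bondsIn (k + 1) (s'.Ω (k + 1))ᶜ)).toFinset} =>
          (avOfRecord F N p.K k).avg
            ((MeasurableEquiv.piEquivPiSubtypeProd (fun _ : PBond (F.P p.K) k => SU N)
              (· ∈ (Set.toFinite (bondsIn k (s'.Ω (k + 1))ᶜ)).toFinset)).symm q) c)) (Ψ z) = z.1)
    (hwS : ∀ q : (↥(Set.toFinite (bondsIn k (s'.Ω (k + 1))ᶜ)).toFinset → SU N) × ({b : PBond (F.P p.K) k // b ∉ (Set.toFinite (bondsIn k (s'.Ω (k + 1))ᶜ)).toFinset} → SU N), q ∉ S →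
      wOfRecord₉ F N θ.toStage9Params p (gOfRecord₁₃ F N θ.toStage13Params p) k s' (⇑(MeasurableEquiv.piEquivPiSubtypeProd (fun _ : PBond (F.P p.K) k => SU N)
            (· ∈ (Set.toFinite (bondsIn k (s'.Ω (k + 1))ᶜ)).toFinset)).symm q) ((avOfRecord F N p.K k).avg (⇑(MeasurableEquiv.piEquivPiSubtypeProd (fun _ : PBond (F.P p.K) k => SU N)
            (· ∈ (Set.toFinite (bondsIn k (s'.Ω (k + 1))ᶜ)).toFinset)).symm q)) = 0)
    -- THE EXPLICIT INTEGRAL IDENTITY PER OLD BRANCH, ON THE CHART ([I] §2 + Jacobian + gauge fixing + ζ + [III] Thm 2 — displayed)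
    (hinner₀ : ∀ᵐ q ∂((Measure.pi fun _ : ↥(Set.toFinite (bondsIn (k + 1) (s'.Ω (k + 1))ᶜ)).toFinset => (HaarData.haar : Measure (SU N))).prod
          (Measure.pi fun _ : {c : PBond (F.P p.K) (k + 1) // c ∉ (Set.toFinite (bondsIn (k + 1) (s'.Ω (k + 1))ᶜ)).toFinset} =>
            (HaarData.haar : Measure (SU N)))),
      ∀ S₀ ∈ admSOfRecord F θ.ν θ.τ9.M (gOfRecord₁₃ F N θ.toStage13Params p) p.K k s'.init, ∀ y : ↥(Set.toFinite (bondsIn k (s'.Ω (k + 1))ᶜ)).toFinset → SU N,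
        avgRestrOfRecord F N p.K k (Set.toFinite (bondsIn k (s'.Ω (k + 1))ᶜ)).toFinset (Set.toFinite (bondsIn (k + 1) (s'.Ω (k + 1))ᶜ)).toFinset y = q.1 →
        (∫ x, (J ((y, q.2), x) : ℝ) * ((fun U => wOfRecord₉ F N θ.toStage9Params p (gOfRecord₁₃ F N θ.toStage13Params p) k s' U ((avOfRecord F N p.K k).avg U) *
        (chiSeqOfRecord F N θ.ν θ.τ9.M (gOfRecord₁₃ F N θ.toStage13Params p) p.K k s'.init U *
          tkBranchOfRecord F N (FluctV N) θ.ν θ.τ9.M (gOfRecord₁₃ F N θ.toStage13Params p) p.K (WtOfRecord₁₃H F N θ p s'.init) s'.init S₀ k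
            (fun ω => (sect2Operand F N (FluctV N) p.K (settingOfRecord₁₃ F N θ.toStage13Params p) (θ.rzAt p s'.init) s'.init (t s'.init) (Ek s'.init)
            (UbgOfRecord₁₃CoP F N θ.toStage13Params p k s'.init)) (S₀, fun j => (ω j).2) (fun j => (ω j).1)) (baseCfg k U))) ∘
          ⇑(MeasurableEquiv.piEquivPiSubtypeProd (fun _ : PBond (F.P p.K) k => SU N)
            (· ∈ (Set.toFinite (bondsIn k (s'.Ω (k + 1))ᶜ)).toFinset)).symm) (Ψ ((y, q.2), x)) ∂(κ (y, q.2))) =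
          ∑ Y ∈ (Set.toFinite {Y : Set (Site (F.P p.K) 0) | Y ∈ SClassOfRecord F θ.ν (gOfRecord₁₃ F N θ.toStage13Params p) p.K (k + 1) ∧ Y ⊆ s'.Ω (k + 1) ∩ (s'.Λ (k + 1))ᶜ}).toFinset,
            zetaOp (genDataOfRecord F N (FluctV N) θ.ν θ.τ9.M (gOfRecord₁₃ F N θ.toStage13Params p) p.K (WtOfRecord₁₃H F N θ p s') s' (Function.update S₀ (k + 1) Y) k).ζ
              (aOp k (genDataOfRecord F N (FluctV N) θ.ν θ.τ9.M (gOfRecord₁₃ F N θ.toStage13Params p) p.K (WtOfRecord₁₃H F N θ p s') s' (Function.update S₀ (k + 1) Y) k).sA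
                (genDataOfRecord F N (FluctV N) θ.ν θ.τ9.M (gOfRecord₁₃ F N θ.toStage13Params p) p.K (WtOfRecord₁₃H F N θ p s') s' (Function.update S₀ (k + 1) Y) k).w
                (tkBranchOfRecord F N (FluctV N) θ.ν θ.τ9.M (gOfRecord₁₃ F N θ.toStage13Params p) p.K (WtOfRecord₁₃H F N θ p s') s'.init S₀ k
                  (fun ω => (sect2Operand F N (FluctV N) p.K (settingOfRecord₁₃ F N θ.toStage13Params p) (θ.rzAt p s') s' t' E'
                  (UbgOfRecord₁₃CoP F N θ.toStage13Params p (k + 1) s')) (Function.update S₀ (k + 1) Y, fun j => (ω j).2) (fun j => (ω j).1))))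
              (Function.update (baseCfg (k + 1) ((MeasurableEquiv.piEquivPiSubtypeProd (fun _ : PBond (F.P p.K) (k + 1) => SU N)
                (· ∈ (Set.toFinite (bondsIn (k + 1) (s'.Ω (k + 1))ᶜ)).toFinset)).symm q)) k
              (Function.updateFinset ((baseCfg (V := FluctV N) (k + 1) ((MeasurableEquiv.piEquivPiSubtypeProd (fun _ : PBond (F.P p.K) (k + 1) => SU N)
                (· ∈ (Set.toFinite (bondsIn (k + 1) (s'.Ω (k + 1))ᶜ)).toFinset)).symm q)) k).1 (Set.toFinite (bondsIn k (s'.Ω (k + 1))ᶜ)).toFinset y,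
                ((baseCfg (V := FluctV N) (k + 1) ((MeasurableEquiv.piEquivPiSubtypeProd (fun _ : PBond (F.P p.K) (k + 1) => SU N)
                (· ∈ (Set.toFinite (bondsIn (k + 1) (s'.Ω (k + 1))ᶜ)).toFinset)).symm q)) k).2))) :
    slotsTOfRecord F N θ.ν θ.τ9 (EOfRecord₁₃ F N θ.toStage13Params) (wOfRecord₉ F N θ.toStage9Params) θ.ppSel p
        (gOfRecord₁₃ F N θ.toStage13Params p) (k + 1) s' = 0 ∨
      ∀ᵐ V' ∂fieldMeasure (F.P p.K) (k + 1) (SU N),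
        chiSeqOfRecord F N θ.ν θ.τ9.M (gOfRecord₁₃ F N θ.toStage13Params p) p.K (k + 1) s' V' ≠ 0 →
          slotsTOfRecord F N θ.ν θ.τ9 (EOfRecord₁₃ F N θ.toStage13Params) (wOfRecord₉ F N θ.toStage9Params) θ.ppSel p
              (gOfRecord₁₃ F N θ.toStage13Params p) (k + 1) s' V' =
            sect2Slot F N (FluctV N) p.K (settingOfRecord₁₃ F N θ.toStage13Params p) (θ.rzAt p s') (WtOfRecord₁₃H F N θ p s') s' t' E'
              (UbgOfRecord₁₃CoP F N θ.toStage13Params p (k + 1) s') V' := by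
  rcases (hform.2 s'.init).2 with h0 | hae
  · exact Or.inl (slotsTOfRecord_succ_eq_zero_of_init_eq_zero F N θ.ν θ.τ9 _ _ θ.ppSel p _ _ s' h0)
  · -- the rows `hG`, `0 ≤ w`, measurability of `w`'s graph section ∕ `χ_k` ∕ the old weights are THEOREMS of the core provisos; `hG₀` by dag-n11-d's C3 §3
    have hG := hG_at_record₁₃_of_provisos θ h p hkK s'
    have hζ0 := zetaOfRecord_nonneg F N θ.ν θ.τ9.M h.zetaUnity h.zetaAbs
    have hw0 : ∀ U, 0 ≤ wOfRecord₉ F N θ.toStage9Params p (gOfRecord₁₃ F N θ.toStage13Params p) k s' U ((avOfRecord F N p.K k).avg U) :=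
      fun U => wOfRecord_nonneg F N θ.ν θ.τ9.M p _ k θ.A₁ hζ0 s' U _
    have hW2 := (h.tstep p k hkK).measW s'
    have hgr : Measurable fun U : GaugeField (F.P p.K) k (SU N) => ((avOfRecord F N p.K k).avg U, U) :=
      (avOfRecord_measurable F N p.K k).prodMk measurable_id
    have hwm : Measurable fun U => wOfRecord₉ F N θ.toStage9Params p (gOfRecord₁₃ F N θ.toStage13Params p) k s' U ((avOfRecord F N p.K k).avg U) := by
      have h' := hW2.comp hgr  -- elaborated WITHOUT the expected type (else the unifier unfolds `wOfRecord`'s label sum)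
      exact h'
    have hχm : Measurable fun U => chiSeqOfRecord F N θ.ν θ.τ9.M (gOfRecord₁₃ F N θ.toStage13Params p) p.K k s'.init U :=
      measurable_chiSeqOfRecord_of_localBg (localBgMeasurable F N θ.ν) θ.τ9.M _ p.K k s'.init
    have hG₀ := integrable_oldBranch_pieces₁₃H_of_integrable_graph θ p s' t Ek hG hae h.zhLaws hw0 hwm hχm hζ0m hqm hΦ₀m
    have hζWm : ∀ j Y, Measurable ((WtOfRecord₁₃H F N θ p s'.init).ζ j Y) := fun j Y =>
      measurable_tkWeightsOfRecordP_ζ F N (FluctV N) θ.ν θ.A₁ p (gOfRecord₁₃ F N θ.toStage13Params p) (θ.zhAt p s'.init) j Y (hζ0m j Y)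
    have hwWm : ∀ j Λ' Y S, Measurable ((WtOfRecord₁₃H F N θ p s'.init).w j Λ' Y S) := fun j Λ' Y S =>
      measurable_tkWeightsOfRecordP_w F N (FluctV N) θ.ν θ.A₁ p (gOfRecord₁₃ F N θ.toStage13Params p) (θ.zhAt p s'.init) j Λ' Y S (hqm j Λ')
    exact Or.inr ((slotsTOfRecord_succ_ae_eq_TkOfRecord_succ_of_oldBranchInnerChart_of_laws θ.ν θ.τ9 (EOfRecord₁₃ F N θ.toStage13Params)
      (wOfRecord₉ F N θ.toStage9Params) θ.ppSel p (gOfRecord₁₃ F N θ.toStage13Params p) hkK (hdec := hdec) (hdec' := hdec') hk s'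
      (WtOfRecord₁₃H F N θ p s'.init) (WtOfRecord₁₃H F N θ p s')
      (sect2Operand F N (FluctV N) p.K (settingOfRecord₁₃ F N θ.toStage13Params p) (θ.rzAt p s'.init) s'.init (t s'.init) (Ek s'.init)
            (UbgOfRecord₁₃CoP F N θ.toStage13Params p k s'.init))
      (sect2Operand F N (FluctV N) p.K (settingOfRecord₁₃ F N θ.toStage13Params p) (θ.rzAt p s') s' t' E'
                  (UbgOfRecord₁₃CoP F N θ.toStage13Params p (k + 1) s'))
      hae hG₀ κ hΨ hJ hpush hfib hwS hwm hχm hζWm hwWm hΦ₀m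
      (hgm_at_record₁₃_of_rows θ p (hdec := hdec) (hdec' := hdec') s' t' E' hζm hqm' hΦm) (WtOfRecord₁₃H_laws h.zhLaws p s')
      (fun S _ ω => (sect2Operand_pos p.K _ _ s' t' E' _ (S, fun j => (ω j).2) (fun j => (ω j).1)).le) hinner₀).mono fun _ hV' _ => hV')

end Stage13

end Summit.QuantumFields.YangMills.Theorems.BalabanUVNodesN11TStepOldBranchInnerChartOfProvisos

end
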